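import Literature.Geometry.Lorentzian.KerrCylinderSpinExpansion
import Literature.Geometry.Lorentzian.InteriorKerrGluingProofs
import HarnessLib

/-!
# The tangential Killing initial data of the Schwarzschild cylinder data

Support file (all results proved; no named facts) for the named fact `LiMei.interiorKerrGluing`
(`InteriorKerrGluing.lean`; J. Li, H. Mei, *A construction of collapsing spacetimes in vacuum*,
Comm. Math. Phys. 378 (2020) = arXiv:2005.01249, Prop. 4.1). Step "S4" of the printed proof
(loc. cit. p. 24): *"the kernel of the formal adjoint of the linearised constraint map at
`(ḡ_{m₀}, k̄_{m₀})` on the annulus is spanned by the Killing fields `∂_t, Ω₁, Ω₂, Ω₃`"*. All four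
fields are TANGENT to the cylinder `{r = r₀}`, so as Killing initial data (KIDs; Moncrief 1975,
Beig–Chruściel 1997) they are the pairs `(N, Y) = (0, Y)`, for which the KID equations reduce to
`𝓛_Y ḡ = 0` and `𝓛_Y k̄ = 0`. This file proves these two equations (the inclusion "⊇" of the
printed sentence) for the tree's coordinate expressions `gbarRep M r₀`, `kbarRep M r₀`
(`InteriorKerrGluingProofs.lean`; polar coordinates `(t, ω) = (‖y‖, y/‖y‖)` on `E3 ∖ {0}`):

* `LiMei.coordLie₂` — the coordinate Lie derivative of a field of bilinear forms along a vector
  field, `(𝓛_Y T)(v, w) = ∂_Y T(v, w) + T(DY v, w) + T(v, DY w)`;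
* `LiMei.coordLie₂_gbarRep_dirVec`, `LiMei.coordLie₂_kbarRep_dirVec` — **`𝓛_{∂_t} ḡ = 𝓛_{∂_t} k̄ = 0`**,
  `∂_t = y/‖y‖` (`t = ‖y‖ + τ₀`), with `D(y/‖y‖) v = tanVec y v`;
* `LiMei.coordLie₂_gbarRep_skew`, `LiMei.coordLie₂_kbarRep_skew` — **`𝓛_{Ay} ḡ = 𝓛_{Ay} k̄ = 0`** for
  every skew-adjoint `A` (the infinitesimal rotations `Ω_i`).

Both tensors are constant combinations of `dt ⊗ dt = ⟪y, ·⟫⟪y, ·⟫/‖y‖²` (`dtSq`) and of the round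
metric `dΩ²` pulled back by `y ↦ y/‖y‖` (`roundForm`), for which the two invariances are proved
first. The reverse inclusion (these span the kernel) is the statement that the Killing algebra of
`ℝ × S²(r₀)` is `ℝ ⊕ so(3)`; it is not needed here and not proved.

## References

* J. Li, H. Mei, arXiv:2005.01249, §4, p. 24 (key `LiMei2020`).
* V. Moncrief, *Spacetime symmetries and linearization stability of the Einstein equations. I*,
  J. Math. Phys. 16 (1975) 493–498; R. Beig, P. T. Chruściel, *Killing initial data*, Class.
  Quantum Grav. 14 (1997) A83–A92 (KIDs).
-/

noncomputable section

open Set Filter Function Metric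
open scoped Topology RealInnerProductSpace

namespace Literature.Geometry.Lorentzian

namespace LiMei

/-! ### The coordinate Lie derivative of a field of bilinear forms -/

/-- The coordinate Lie derivative of a field `T` of bilinear forms (given as a function of the point
and two vectors) along a vector field `Y`:
`(𝓛_Y T)_y(v, w) = ∂_{Y(y)} T(·)(v, w) + T_y(DY(y) v, w) + T_y(v, DY(y) w)`. For a pair `(N, Y)` with
`N = 0` the KID equations of data `(h, k)` are `𝓛_Y h = 0`, `𝓛_Y k = 0` (Beig–Chruściel 1997, §2).
[folklore] -/
def coordLie₂ (T : E3 → E3 → E3 → ℝ) (Y : E3 → E3) (y v w : E3) : ℝ :=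
  fderiv ℝ (fun z ↦ T z v w) y (Y y) + T y (fderiv ℝ Y y v) w + T y v (fderiv ℝ Y y w)

/-- `𝓛` is linear in the tensor: constant combinations. [folklore] -/
theorem coordLie₂_const_mul_add_const_mul {T₁ T₂ : E3 → E3 → E3 → ℝ} {Y : E3 → E3} {y : E3}
    (c₁ c₂ : ℝ) (v w : E3) (h₁ : DifferentiableAt ℝ (fun z ↦ T₁ z v w) y)
    (h₂ : DifferentiableAt ℝ (fun z ↦ T₂ z v w) y) :
    coordLie₂ (fun z a b ↦ c₁ * T₁ z a b + c₂ * T₂ z a b) Y y v w =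
      c₁ * coordLie₂ T₁ Y y v w + c₂ * coordLie₂ T₂ Y y v w := by
  simp only [coordLie₂]
  have h : HasFDerivAt (fun z ↦ c₁ * T₁ z v w + c₂ * T₂ z v w)
      (c₁ • fderiv ℝ (fun z ↦ T₁ z v w) y + c₂ • fderiv ℝ (fun z ↦ T₂ z v w) y) y :=
    (h₁.hasFDerivAt.const_mul c₁).add (h₂.hasFDerivAt.const_mul c₂)
  rw [h.fderiv]
  simp only [add_apply, FunLike.coe_smul, Pi.smul_apply, smul_eq_mul]
  ring

/-! ### The two basic tensors `dt ⊗ dt` and `dΩ²` -/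

/-- `dt ⊗ dt` in the coordinates `y` (`t = ‖y‖`): `⟪y, v⟫⟪y, w⟫/‖y‖²`. [folklore] -/
def dtSq (y v w : E3) : ℝ := ⟪y, v⟫ * ⟪y, w⟫ / ‖y‖ ^ 2

/-- The round metric of the unit sphere pulled back by `y ↦ y/‖y‖`:
`(⟪v, w⟫ − ⟪y, v⟫⟪y, w⟫/‖y‖²)/‖y‖²`. [folklore] -/
def roundForm (y v w : E3) : ℝ := (⟪v, w⟫ - ⟪y, v⟫ * ⟪y, w⟫ / ‖y‖ ^ 2) / ‖y‖ ^ 2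

/-- `ḡ_M = (2M/r₀ − 1) dt² + r₀² dΩ²`. [cite: LiMei2020, (4.1)] -/
theorem gbarRep_eq (M r₀ : ℝ) (y v w : E3) :
    gbarRep M r₀ y v w = (2 * M / r₀ - 1) * dtSq y v w + r₀ ^ 2 * roundForm y v w := by
  simp only [gbarRep, dtSq, roundForm]
  ring

/-- `k̄_M = M r₀⁻² (2M/r₀ − 1)^{1/2} dt² − r₀ (2M/r₀ − 1)^{1/2} dΩ²`. [cite: LiMei2020, (4.1)] -/
theorem kbarRep_eq (M r₀ : ℝ) (y v w : E3) :
    kbarRep M r₀ y v w = M / r₀ ^ 2 * Real.sqrt (2 * M / r₀ - 1) * dtSq y v w +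
      -(r₀ * Real.sqrt (2 * M / r₀ - 1)) * roundForm y v w := by
  simp only [kbarRep, dtSq, roundForm]
  ring

/-- The derivative of `y ↦ dt²_y(v, w)`. [folklore] -/
theorem hasFDerivAt_dtSq {y : E3} (hy : y ≠ 0) (v w : E3) :
    HasFDerivAt (fun z : E3 ↦ dtSq z v w)
      ((⟪y, w⟫ * (‖y‖ ^ 2)⁻¹) • E3.covec v + (⟪y, v⟫ * (‖y‖ ^ 2)⁻¹) • E3.covec w +
        (⟪y, v⟫ * ⟪y, w⟫ * (-(2 : ℕ) / ‖y‖ ^ (2 + 2))) • E3.covec y) y := by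
  have h := ((Kerr.hasFDerivAt_inner_left y v).mul (Kerr.hasFDerivAt_inner_left y w)).mul
    (Kerr.hasFDerivAt_inv_norm_pow hy 2)
  have hfun : (fun z : E3 ↦ dtSq z v w) = fun z ↦ ⟪z, v⟫ * ⟪z, w⟫ * (‖z‖ ^ 2)⁻¹ := by
    funext z; rw [dtSq, div_eq_mul_inv]
  rw [hfun]
  refine h.congr_fderiv ?_
  ext u
  simp only [add_apply, FunLike.coe_smul, Pi.smul_apply, E3.covec_apply, smul_eq_mul, Pi.mul_apply]
  ring

/-- The derivative of `y ↦ dΩ²_y(v, w)`. [folklore] -/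
theorem hasFDerivAt_roundForm {y : E3} (hy : y ≠ 0) (v w : E3) :
    HasFDerivAt (fun z : E3 ↦ roundForm z v w)
      ((⟪v, w⟫ * (-(2 : ℕ) / ‖y‖ ^ (2 + 2))) • E3.covec y -
        ((⟪y, w⟫ * (‖y‖ ^ 4)⁻¹) • E3.covec v + (⟪y, v⟫ * (‖y‖ ^ 4)⁻¹) • E3.covec w +
          (⟪y, v⟫ * ⟪y, w⟫ * (-(4 : ℕ) / ‖y‖ ^ (4 + 2))) • E3.covec y)) y := by
  have h1 := (Kerr.hasFDerivAt_inv_norm_pow hy 2).const_mul ⟪v, w⟫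
  have h2 := ((Kerr.hasFDerivAt_inner_left y v).mul (Kerr.hasFDerivAt_inner_left y w)).mul
    (Kerr.hasFDerivAt_inv_norm_pow hy 4)
  have h := h1.sub h2
  have hn : ‖y‖ ≠ 0 := norm_ne_zero_iff.2 hy
  have hfun : (fun z : E3 ↦ roundForm z v w) =ᶠ[𝓝 y]
      fun z ↦ ⟪v, w⟫ * (‖z‖ ^ 2)⁻¹ - ⟪z, v⟫ * ⟪z, w⟫ * (‖z‖ ^ 4)⁻¹ := by
    filter_upwards [isOpen_ne.mem_nhds hy] with z hz
    have hz' : ‖z‖ ≠ 0 := norm_ne_zero_iff.2 hz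
    rw [roundForm]
    field_simp
  refine (h.congr_of_eventuallyEq hfun).congr_fderiv ?_
  ext u
  simp only [sub_apply, add_apply, FunLike.coe_smul, Pi.smul_apply, E3.covec_apply, smul_eq_mul,
    Pi.mul_apply]
  ring

/-- `y ↦ dt²_y(v, w)` is differentiable off the origin. [folklore] -/
theorem differentiableAt_dtSq {y : E3} (hy : y ≠ 0) (v w : E3) :
    DifferentiableAt ℝ (fun z : E3 ↦ dtSq z v w) y :=
  (hasFDerivAt_dtSq hy v w).differentiableAt

/-- `y ↦ dΩ²_y(v, w)` is differentiable off the origin. [folklore] -/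
theorem differentiableAt_roundForm {y : E3} (hy : y ≠ 0) (v w : E3) :
    DifferentiableAt ℝ (fun z : E3 ↦ roundForm z v w) y :=
  (hasFDerivAt_roundForm hy v w).differentiableAt

/-! ### The time translation `∂_t = y/‖y‖` -/

/-- `D(y/‖y‖) v = tanVec y v`. [folklore] -/
theorem hasFDerivAt_dirVec {y : E3} (hy : y ≠ 0) :
    HasFDerivAt dirVec ((‖y‖ ^ 1)⁻¹ • ContinuousLinearMap.id ℝ E3 +
      (((-(1 : ℕ) : ℝ) / ‖y‖ ^ (1 + 2)) • E3.covec y).smulRight y) y := by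
  have h := (Kerr.hasFDerivAt_inv_norm_pow hy 1).smul (hasFDerivAt_id y)
  have hfun : dirVec = fun z : E3 ↦ (‖z‖ ^ 1)⁻¹ • z := by
    funext z; rw [dirVec, pow_one]
  rw [hfun]
  exact h

/-- `fderiv (y/‖y‖) v = tanVec y v`. [folklore] -/
theorem fderiv_dirVec_apply {y : E3} (hy : y ≠ 0) (v : E3) : fderiv ℝ dirVec y v = tanVec y v := by
  rw [(hasFDerivAt_dirVec hy).fderiv]
  simp only [pow_one, Nat.cast_one, add_apply, FunLike.coe_smul, Pi.smul_apply,
    ContinuousLinearMap.id_apply, ContinuousLinearMap.smulRight_apply, E3.covec_apply, tanVec]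
  norm_num

/-- **`𝓛_{∂_t} dt² = 0`.** [folklore] -/
theorem coordLie₂_dtSq_dirVec {y : E3} (hy : y ≠ 0) (v w : E3) : coordLie₂ dtSq dirVec y v w = 0 := by
  have hn : ‖y‖ ≠ 0 := norm_ne_zero_iff.2 hy
  rw [coordLie₂, (hasFDerivAt_dtSq hy v w).fderiv, fderiv_dirVec_apply hy, fderiv_dirVec_apply hy]
  simp only [dtSq, dirVec, tanVec, add_apply, FunLike.coe_smul, Pi.smul_apply, E3.covec_apply,
    smul_eq_mul, inner_add_right, inner_smul_right, real_inner_self_eq_norm_sq, real_inner_comm y v,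
    real_inner_comm y w]
  push_cast
  field_simp
  ring

/-- **`𝓛_{∂_t} dΩ² = 0`.** [folklore] -/
theorem coordLie₂_roundForm_dirVec {y : E3} (hy : y ≠ 0) (v w : E3) :
    coordLie₂ roundForm dirVec y v w = 0 := by
  have hn : ‖y‖ ≠ 0 := norm_ne_zero_iff.2 hy
  rw [coordLie₂, (hasFDerivAt_roundForm hy v w).fderiv, fderiv_dirVec_apply hy, fderiv_dirVec_apply hy]
  simp only [roundForm, dirVec, tanVec, sub_apply, add_apply, FunLike.coe_smul, Pi.smul_apply,
    E3.covec_apply, smul_eq_mul, inner_add_left, inner_add_right, inner_smul_left, inner_smul_right,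
    real_inner_self_eq_norm_sq, real_inner_comm y v, real_inner_comm y w, conj_trivial]
  push_cast
  field_simp
  ring

/-! ### The infinitesimal rotations `y ↦ A y`, `A` skew -/

/-- **`𝓛_{A} dt² = 0`** for a skew-adjoint `A`. [folklore] -/
theorem coordLie₂_dtSq_skew (A : E3 →L[ℝ] E3) (hA : ∀ u u' : E3, ⟪A u, u'⟫ = -⟪u, A u'⟫) {y : E3}
    (hy : y ≠ 0) (v w : E3) : coordLie₂ dtSq (fun z ↦ A z) y v w = 0 := by
  have hn : ‖y‖ ≠ 0 := norm_ne_zero_iff.2 hy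
  have hAy : ⟪y, A y⟫ = 0 := by
    have h := hA y y
    rw [real_inner_comm y (A y)] at h
    linarith
  have hAv : ⟪y, A v⟫ = -⟪A y, v⟫ := by rw [hA y v]; ring
  have hAw : ⟪y, A w⟫ = -⟪A y, w⟫ := by rw [hA y w]; ring
  rw [coordLie₂, (hasFDerivAt_dtSq hy v w).fderiv, A.fderiv]
  simp only [dtSq, add_apply, FunLike.coe_smul, Pi.smul_apply, E3.covec_apply, smul_eq_mul, hAy,
    hAv, hAw, real_inner_comm (A y) v, real_inner_comm (A y) w]
  push_cast
  field_simp
  ring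

/-- **`𝓛_{A} dΩ² = 0`** for a skew-adjoint `A`. [folklore] -/
theorem coordLie₂_roundForm_skew (A : E3 →L[ℝ] E3) (hA : ∀ u u' : E3, ⟪A u, u'⟫ = -⟪u, A u'⟫)
    {y : E3} (hy : y ≠ 0) (v w : E3) : coordLie₂ roundForm (fun z ↦ A z) y v w = 0 := by
  have hn : ‖y‖ ≠ 0 := norm_ne_zero_iff.2 hy
  have hAy : ⟪y, A y⟫ = 0 := by
    have h := hA y y
    rw [real_inner_comm y (A y)] at h
    linarith
  have hAv : ⟪y, A v⟫ = -⟪A y, v⟫ := by rw [hA y v]; ring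
  have hAw : ⟪y, A w⟫ = -⟪A y, w⟫ := by rw [hA y w]; ring
  have hAvw : ⟪v, A w⟫ = -⟪A v, w⟫ := by rw [hA v w]; ring
  rw [coordLie₂, (hasFDerivAt_roundForm hy v w).fderiv, A.fderiv]
  simp only [roundForm, sub_apply, add_apply, FunLike.coe_smul, Pi.smul_apply, E3.covec_apply,
    smul_eq_mul, hAy, hAv, hAw, hAvw, real_inner_comm (A y) v, real_inner_comm (A y) w]
  push_cast
  field_simp
  ring

/-! ### The Schwarzschild cylinder data -/

/-- **`𝓛_{∂_t} ḡ_M = 0`**: the time translation is a tangential KID of the Schwarzschild cylinder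
data (Li–Mei p. 24: `∂_t` is in the kernel). [cite: LiMei2020, p. 24] -/
theorem coordLie₂_gbarRep_dirVec (M r₀ : ℝ) {y : E3} (hy : y ≠ 0) (v w : E3) :
    coordLie₂ (gbarRep M r₀) dirVec y v w = 0 := by
  have e : gbarRep M r₀ = fun z a b ↦ (2 * M / r₀ - 1) * dtSq z a b + r₀ ^ 2 * roundForm z a b := by
    funext z a b; exact gbarRep_eq M r₀ z a b
  rw [e, coordLie₂_const_mul_add_const_mul _ _ v w (differentiableAt_dtSq hy v w)
    (differentiableAt_roundForm hy v w), coordLie₂_dtSq_dirVec hy, coordLie₂_roundForm_dirVec hy]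
  ring

/-- **`𝓛_{∂_t} k̄_M = 0`.** [cite: LiMei2020, p. 24] -/
theorem coordLie₂_kbarRep_dirVec (M r₀ : ℝ) {y : E3} (hy : y ≠ 0) (v w : E3) :
    coordLie₂ (kbarRep M r₀) dirVec y v w = 0 := by
  have e : kbarRep M r₀ = fun z a b ↦ M / r₀ ^ 2 * Real.sqrt (2 * M / r₀ - 1) * dtSq z a b +
      -(r₀ * Real.sqrt (2 * M / r₀ - 1)) * roundForm z a b := by
    funext z a b; exact kbarRep_eq M r₀ z a b
  rw [e, coordLie₂_const_mul_add_const_mul _ _ v w (differentiableAt_dtSq hy v w)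
    (differentiableAt_roundForm hy v w), coordLie₂_dtSq_dirVec hy, coordLie₂_roundForm_dirVec hy]
  ring

/-- **`𝓛_{A} ḡ_M = 0` for every skew-adjoint `A`**: the rotations `Ω₁, Ω₂, Ω₃` are tangential KIDs
of the Schwarzschild cylinder data (Li–Mei p. 24). [cite: LiMei2020, p. 24] -/
theorem coordLie₂_gbarRep_skew (M r₀ : ℝ) (A : E3 →L[ℝ] E3) (hA : ∀ u u' : E3, ⟪A u, u'⟫ = -⟪u, A u'⟫)
    {y : E3} (hy : y ≠ 0) (v w : E3) : coordLie₂ (gbarRep M r₀) (fun z ↦ A z) y v w = 0 := by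
  have e : gbarRep M r₀ = fun z a b ↦ (2 * M / r₀ - 1) * dtSq z a b + r₀ ^ 2 * roundForm z a b := by
    funext z a b; exact gbarRep_eq M r₀ z a b
  rw [e, coordLie₂_const_mul_add_const_mul _ _ v w (differentiableAt_dtSq hy v w)
    (differentiableAt_roundForm hy v w), coordLie₂_dtSq_skew A hA hy, coordLie₂_roundForm_skew A hA hy]
  ring

/-- **`𝓛_{A} k̄_M = 0` for every skew-adjoint `A`.** [cite: LiMei2020, p. 24] -/
theorem coordLie₂_kbarRep_skew (M r₀ : ℝ) (A : E3 →L[ℝ] E3) (hA : ∀ u u' : E3, ⟪A u, u'⟫ = -⟪u, A u'⟫)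
    {y : E3} (hy : y ≠ 0) (v w : E3) : coordLie₂ (kbarRep M r₀) (fun z ↦ A z) y v w = 0 := by
  have e : kbarRep M r₀ = fun z a b ↦ M / r₀ ^ 2 * Real.sqrt (2 * M / r₀ - 1) * dtSq z a b +
      -(r₀ * Real.sqrt (2 * M / r₀ - 1)) * roundForm z a b := by
    funext z a b; exact kbarRep_eq M r₀ z a b
  rw [e, coordLie₂_const_mul_add_const_mul _ _ v w (differentiableAt_dtSq hy v w)
    (differentiableAt_roundForm hy v w), coordLie₂_dtSq_skew A hA hy, coordLie₂_roundForm_skew A hA hy]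
  ring

/-- The three infinitesimal rotations `Ω_i y = e_i × y` are skew-adjoint; for instance the rotation
about the spin axis, `y ↦ (−y₁, y₀, 0)`. [folklore] -/
theorem inner_axialTwist_skew (u u' : E3) :
    ⟪(WithLp.toLp 2 ![-u 1, u 0, 0] : E3), u'⟫ = -⟪u, (WithLp.toLp 2 ![-u' 1, u' 0, 0] : E3)⟫ := by
  rw [PiLp.inner_apply, PiLp.inner_apply, Fin.sum_univ_three, Fin.sum_univ_three]
  simp only [RCLike.inner_apply, conj_trivial]
  simp

end LiMei

end Literature.Geometry.Lorentzian

end
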